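import Summits.Ventures.PackingBounds.Configurations.ListConfig
import Mathlib.NumberTheory.Zsqrtd.ToReal
import Summits.Ventures.PackingBounds.Codes.Icosahedron
import Summits.Ventures.PackingBounds.Energy.UniversalOptimality
import Summits.Ventures.PackingBounds.Energy.CoulombDimensionThreeIcosahedron

/-!
# The regular icosahedron as an explicit 12-point configuration on `S²` over `ℤ[√5]`: `A(3, arccos 1/√5) = 12`, ground-state energies, the Thomson problem for `N = 12`

Framing: lottery ticket; floor = certified bounds/negative ranges. Venture `PackingBounds` (cell
`pub-packcert`, seat `pub-packcert-energy`) — the **attained side** for `(n, N) = (3, 12)`.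

`vecs` lists the `12` vertices `(0, ±2, ±(1+√5))` (cyclic) with coordinates in `ℤ[√5]`
(`Zsqrtd 5`, embedded by `Zsqrtd.toReal`), of squared length `10 + 2√5`; the kernel computes the dot
products in `ℤ[√5]` exactly and checks the distance distribution `-1, -1/√5, 1/√5` with multiplicities
`1, 5, 5`. Consequences with the cell's bounds: `A(3, arccos(1/√5)) = 12` (`IsGreatest`, with
`Codes.icosahedron_card_le_12`), the ground-state energy of `12` points on `S²` for every absolutely
monotonic potential (`IsLeast`, universal optimality `Energy.UniversalIcosahedron…`), and the
**Thomson problem for `N = 12`**: the least Coulomb energy `Σ_{x ≠ y} |x - y|⁻¹` of `12` unit vectors of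
`ℝ³` is `6 + 60 (√((5+√5)/8) + √((5-√5)/8))`, attained by the icosahedron (`IsLeast`, lower bound
`Energy.coulomb_energy_card12_ge_icosahedron`).

## References
* H. Cohn, A. Kumar, J. Amer. Math. Soc. 20 (2007) 99–148, Table 1. [`CohnKumar2006`]
* N. N. Andreev, *An extremal property of the icosahedron*, East J. Approx. 2 (1996) 459–462. [`Andreev1996`]
-/

namespace Summit.Ventures.PackingBounds.Config.Icosahedron

open Finset Summit.Ventures.PackingBounds.Config

/-- `0 ≤ 5`. -/
theorem h5 : (0 : ℤ) ≤ 5 := by norm_num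

/-- `5` is not a square. -/
theorem d5_not_square : ∀ n : ℤ, (5 : ℤ) ≠ n * n := by
  intro n h
  have h1 : n.natAbs * n.natAbs = 5 := by
    have := Int.natAbs_mul_self' n; omega
  have h2 : n.natAbs ≤ 2 := by nlinarith
  interval_cases n.natAbs <;> omega

/-- `(√5)² = 5`. -/
private theorem hX : Real.sqrt 5 ^ 2 = 5 := Real.sq_sqrt (by norm_num)

/-- `2.236 < √5`. -/
private theorem hlo : (2.236 : ℝ) < Real.sqrt 5 := (Real.lt_sqrt (by norm_num)).mpr (by norm_num)

/-- `√5 < 2.2361`. -/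
private theorem hhi : Real.sqrt 5 < 2.2361 := (Real.sqrt_lt' (by norm_num)).mpr (by norm_num)

set_option maxHeartbeats 4000000 in
/-- The `12` vertices `(0, ±2, ±(1+√5))` and cyclic permutations, over `ℤ[√5]`. [cite: CohnKumar2006, Table 1] -/
def vecs : List (List (Zsqrtd 5)) := [
  [⟨0, 0⟩, ⟨2, 0⟩, ⟨1, 1⟩],
  [⟨1, 1⟩, ⟨0, 0⟩, ⟨2, 0⟩],
  [⟨2, 0⟩, ⟨1, 1⟩, ⟨0, 0⟩],
  [⟨0, 0⟩, ⟨2, 0⟩, ⟨-1, -1⟩],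
  [⟨-1, -1⟩, ⟨0, 0⟩, ⟨2, 0⟩],
  [⟨2, 0⟩, ⟨-1, -1⟩, ⟨0, 0⟩],
  [⟨0, 0⟩, ⟨-2, 0⟩, ⟨1, 1⟩],
  [⟨1, 1⟩, ⟨0, 0⟩, ⟨-2, 0⟩],
  [⟨-2, 0⟩, ⟨1, 1⟩, ⟨0, 0⟩],
  [⟨0, 0⟩, ⟨-2, 0⟩, ⟨-1, -1⟩],
  [⟨-1, -1⟩, ⟨0, 0⟩, ⟨-2, 0⟩],
  [⟨-2, 0⟩, ⟨-1, -1⟩, ⟨0, 0⟩]]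

/-- The distance table: dot products of a member with the other members, with multiplicities. -/
def table : List ((Zsqrtd 5) × ℕ) := [(⟨-10, -2⟩, 1), (⟨-2, -2⟩, 5), (⟨2, 2⟩, 5)]

/-- Kernel check: `12` coordinate lists. -/
theorem length_vecs : vecs.length = 12 := by decide +kernel

set_option maxRecDepth 100000 in
/-- Kernel check: the coordinate lists are pairwise distinct. -/
private theorem nodup_vecs : vecs.Nodup := by decide +kernel

set_option maxRecDepth 100000 in
/-- Kernel check: every list has length `3` and the prescribed squared length. -/
private theorem shape_vecs : shapeOK vecs 3 (⟨10, 2⟩ : (Zsqrtd 5)) = true := by decide +kernel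

/-- Kernel check: the table keys are distinct and differ from the squared length. -/
private theorem keys_table : keysOK table (⟨10, 2⟩ : (Zsqrtd 5)) = true := by decide +kernel

set_option maxRecDepth 100000 in
/-- Kernel check (the distance distribution): the dot products of every member with the other members
have exactly the tabulated multiplicities and take no other value. -/
private theorem hist_vecs : histOK vecs table vecs = true := by decide +kernel


/-- The configuration: the normalised coordinate lists as points of `ℝ^3`. -/
noncomputable def pts : Finset (EuclideanSpace ℝ (Fin 3)) := config (Zsqrtd.toReal h5) 3 (⟨10, 2⟩ : (Zsqrtd 5)) vecs

/-- `ι q > 0`. -/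
private theorem hq : 0 < (Zsqrtd.toReal h5) (⟨10, 2⟩ : (Zsqrtd 5)) := by
  rw [Zsqrtd.toReal_apply]; push_cast; nlinarith [Real.sqrt_nonneg 5, hX]

/-- Node value `ι d / ι q` for the table key number `0`. -/
private theorem key_0 : (Zsqrtd.toReal h5) (⟨-10, -2⟩ : (Zsqrtd 5)) / (Zsqrtd.toReal h5) (⟨10, 2⟩ : (Zsqrtd 5)) = (-1 : ℝ) := by
  rw [div_eq_iff hq.ne', Zsqrtd.toReal_apply, Zsqrtd.toReal_apply]
  push_cast
  linear_combination (0 : ℝ) * hX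

/-- Node value `ι d / ι q` for the table key number `1`. -/
private theorem key_1 : (Zsqrtd.toReal h5) (⟨-2, -2⟩ : (Zsqrtd 5)) / (Zsqrtd.toReal h5) (⟨10, 2⟩ : (Zsqrtd 5)) = (-(Real.sqrt 5 / 5) : ℝ) := by
  rw [div_eq_iff hq.ne', Zsqrtd.toReal_apply, Zsqrtd.toReal_apply]
  push_cast
  linear_combination ((2 : ℝ) / 5) * hX

/-- Node value `ι d / ι q` for the table key number `2`. -/
private theorem key_2 : (Zsqrtd.toReal h5) (⟨2, 2⟩ : (Zsqrtd 5)) / (Zsqrtd.toReal h5) (⟨10, 2⟩ : (Zsqrtd 5)) = (Real.sqrt 5 / 5 : ℝ) := by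
  rw [div_eq_iff hq.ne', Zsqrtd.toReal_apply, Zsqrtd.toReal_apply]
  push_cast
  linear_combination ((-2 : ℝ) / 5) * hX

/-- `pts` has `12` points. -/
theorem card_pts : pts.card = 12 := by
  rw [pts, card_eq (Zsqrtd.toReal_injective h5 d5_not_square) hq shape_vecs keys_table hist_vecs nodup_vecs, length_vecs]

/-- Every point of `pts` is a unit vector. -/
private theorem norm_pts : ∀ x ∈ pts, ‖x‖ = 1 := norm_eq_one hq shape_vecs

/-- Distinct points of `pts` have inner product `ι d / ι q` for a key `d` of the table. -/
private theorem inner_pts : ∀ x ∈ pts, ∀ y ∈ pts, x ≠ y → ∃ p ∈ table, inner ℝ x y = (Zsqrtd.toReal h5) p.1 / (Zsqrtd.toReal h5) (⟨10, 2⟩ : (Zsqrtd 5)) :=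
  inner_mem hq shape_vecs hist_vecs

/-- **Energy of the configuration**: for every potential `a`, `Σ_{x ≠ y ∈ pts} a(⟪x,y⟫)` equals the
tabulated value. -/
theorem energy_pts (a : ℝ → ℝ) :
    ∑ x ∈ pts, ∑ y ∈ pts.erase x, a (inner ℝ x y) =
      (12 : ℝ) * (a (-1) + 5 * a (-(Real.sqrt 5 / 5)) + 5 * a (Real.sqrt 5 / 5)) := by
  rw [pts, energy_eq (Zsqrtd.toReal_injective h5 d5_not_square) hq shape_vecs keys_table hist_vecs nodup_vecs a, length_vecs]
  simp only [table, List.map_cons, List.map_nil, List.sum_cons, List.sum_nil, Nat.cast_ofNat, Nat.cast_one]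
  rw [key_0, key_1, key_2]
  ring

/-- Distinct points of `pts` have inner product `≤ Real.sqrt 5 / 5`. -/
private theorem inner_pts_le : ∀ x ∈ pts, ∀ y ∈ pts, x ≠ y → inner ℝ x y ≤ Real.sqrt 5 / 5 := by
  refine inner_le hq shape_vecs hist_vecs (Real.sqrt 5 / 5) fun p hp => ?_
  simp only [table, List.mem_cons, List.not_mem_nil, or_false] at hp
  rcases hp with rfl | rfl | rfl
  · rw [key_0]; linarith [hlo]
  · rw [key_1]; linarith [hlo]
  · rw [key_2]

/-- **Attained**: `12` unit vectors of `ℝ³` with pairwise inner products `≤ 1/√5`. [cite: CohnKumar2006, Table 1] -/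
theorem exists_code_12 : ∃ C : Finset (EuclideanSpace ℝ (Fin 3)),
    C.card = 12 ∧ (∀ x ∈ C, ‖x‖ = 1) ∧ (∀ x ∈ C, ∀ y ∈ C, x ≠ y → inner ℝ x y ≤ Real.sqrt 5 / 5) :=
  ⟨pts, card_pts, norm_pts, inner_pts_le⟩

/-- **`A(3, arccos(1/√5)) = 12`** (two-sided: kernel-checked LP bound over `ℚ(√5)` + this configuration). [cite: CohnKumar2006, Table 1] -/
theorem code_isGreatest : IsGreatest {N : ℕ | ∃ C : Finset (EuclideanSpace ℝ (Fin 3)), C.card = N ∧ (∀ x ∈ C, ‖x‖ = 1) ∧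
      (∀ x ∈ C, ∀ y ∈ C, x ≠ y → inner ℝ x y ≤ Real.sqrt 5 / 5)} 12 := by
  refine ⟨exists_code_12, ?_⟩
  rintro N ⟨C, rfl, h1, h2⟩
  exact Codes.icosahedron_card_le_12 C h1 h2

/-- **Ground-state energy of `12` points on `S²`** for every absolutely monotonic potential (universal optimality lower bound + attained). [cite: CohnKumar2006, Theorem 1.2] -/
theorem energy_isLeast (a : ℝ → ℝ) (ha : AbsolutelyMonotoneOn a (Set.Ico (-1) 1)) :
    IsLeast {E : ℝ | ∃ C : Finset (EuclideanSpace ℝ (Fin 3)), (∀ x ∈ C, ‖x‖ = 1) ∧ C.card = 12 ∧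
      E = ∑ x ∈ C, ∑ y ∈ C.erase x, a (inner ℝ x y)}
      ((12 : ℝ) * (a (-1) + 5 * a (-(Real.sqrt 5 / 5)) + 5 * a (Real.sqrt 5 / 5))) := by
  refine ⟨⟨pts, norm_pts, card_pts, (energy_pts a).symm⟩, ?_⟩
  rintro E ⟨C, h1, hN, rfl⟩
  exact Energy.UniversalIcosahedron.universallyOptimal_of_absolutelyMonotoneOn a ha C h1 hN

/-- **The Thomson problem for `N = 12`.** The least Coulomb energy `Σ_{x ≠ y} |x - y|⁻¹` (ordered
pairs) of `12` unit vectors of `ℝ³` is `6 + 60 (√((5+√5)/8) + √((5-√5)/8))`, attained by the regular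
icosahedron (lower bound: the cell's kernel-checked sharp LP certificate over `ℚ(√5)(cos 18°)`,
`Energy.coulomb_energy_card12_ge_icosahedron`, Andreev 1996). [cite: Andreev1996, Theorem] -/
theorem coulomb_isLeast :
    IsLeast {E : ℝ | ∃ C : Finset (EuclideanSpace ℝ (Fin 3)), (∀ x ∈ C, ‖x‖ = 1) ∧ C.card = 12 ∧
      E = ∑ x ∈ C, ∑ y ∈ C.erase x, ‖x - y‖⁻¹}
      (6 + 60 * (Real.sqrt ((5 + Real.sqrt 5) / 8) + Real.sqrt ((5 - Real.sqrt 5) / 8))) := by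
  refine ⟨⟨pts, norm_pts, card_pts, ?_⟩, ?_⟩
  · -- the Coulomb energy of the icosahedron, from the energy identity with a(t) = (2 - 2t)^{-1/2}
    have hE := energy_pts (fun t => (Real.sqrt (2 - 2 * t))⁻¹)
    have hdist : ∀ x ∈ pts, ∀ y ∈ pts.erase x, ‖x - y‖⁻¹ = (Real.sqrt (2 - 2 * inner ℝ x y))⁻¹ := by
      intro x hx y hy
      have hsq : ‖x - y‖ ^ 2 = 2 - 2 * inner ℝ x y := by
        rw [norm_sub_sq_real, norm_pts x hx, norm_pts y (Finset.mem_of_mem_erase hy)]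
        ring
      rw [← hsq, Real.sqrt_sq (norm_nonneg _)]
    rw [Finset.sum_congr rfl fun x hx => Finset.sum_congr rfl fun y hy => hdist x hx y hy, hE]
    have h1 : Real.sqrt (2 - 2 * (-1 : ℝ)) = 2 := by
      rw [show (2 : ℝ) - 2 * (-1) = 2 ^ 2 by norm_num, Real.sqrt_sq (by norm_num)]
    have hu2 : (2 - 2 * (-(Real.sqrt 5 / 5))) * ((5 - Real.sqrt 5) / 8) = 1 := by
      linear_combination (-1 / 20 : ℝ) * hX
    have hu3 : (2 - 2 * (Real.sqrt 5 / 5)) * ((5 + Real.sqrt 5) / 8) = 1 := by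
      linear_combination (-1 / 20 : ℝ) * hX
    have h2 : (Real.sqrt (2 - 2 * (-(Real.sqrt 5 / 5))))⁻¹ = Real.sqrt ((5 - Real.sqrt 5) / 8) := by
      rw [← Real.sqrt_inv, inv_eq_of_mul_eq_one_right hu2]
    have h3 : (Real.sqrt (2 - 2 * (Real.sqrt 5 / 5)))⁻¹ = Real.sqrt ((5 + Real.sqrt 5) / 8) := by
      rw [← Real.sqrt_inv, inv_eq_of_mul_eq_one_right hu3]
    rw [h1, h2, h3]
    ring
  · rintro E ⟨C, h1, hN, rfl⟩
    exact Energy.coulomb_energy_card12_ge_icosahedron C h1 hN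

end Summit.Ventures.PackingBounds.Config.Icosahedron
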